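import Literature.MathematicalPhysics.QuantumLattice.DWaveOrderParameterRightDerivativeTTPrime
import Literature.MathematicalPhysics.QuantumLattice.DWaveOrderParameterQuasiAverageState
import Literature.MathematicalPhysics.QuantumLattice.DWaveOrderParameterSemicontinuity
import Literature.MathematicalPhysics.QuantumLattice.InfVolFermionStateWeakLimits
import HarnessLib

/-!
# CLOSED GRAPH of the sourced ground-state correspondence of the `t–t'` Hubbard model over the coupling
# space `(t', U, μ, h)`, and joint upper semicontinuity of the finite-field pair amplitude

Topic `Literature/MathematicalPhysics/QuantumLattice` (namespace = path; family `hubbard`). Sequel of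
`InfVolFermionStateWeakLimits.lean` (hubbard-cq-p5: sequential weak-⋆ compactness of the infinite-volume state
space; limits of mean-energy minimisers are minimisers for a FIXED interaction or along a pencil),
`DWaveOrderParameterSemicontinuity.lean` (p5: `e_src(t',U,μ,h) = dWaveSourceEnergyDensityTT'` is jointly
continuous; `m⋆ = dWaveOrderParameterTT'` is u.s.c. in the couplings), `DWaveOrderParameterRightDerivativeTTPrime.lean`
(p5: the response function `m(h) = −∂⁺E(h)/2` is the GREATEST pair amplitude of a translation-invariant sourced
ground state at `h`) and `DWaveOrderParameterQuasiAverageState.lean` (p5: at `h = 0` the greatest amplitude is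
`m⋆`). The ground states at the coupling point `c = (t',U,μ,h)` are the translation-invariant mean-energy
minimisers of `Ψ_c := hubbardTTPrimeSourcedInteraction 1 t' U μ dWaveFormFactor h` (Bratteli–Kishimoto–Robinson).
Written for the Hubbard cuprate cell (`hubbard-cq`, rung CQ). Everything is PROVED; no definition, no named
fact, zero compute.

## Contents

* §1 `InfVolFermionState.meanEnergy_dWaveSourced_sub_eq` / `abs_meanEnergy_dWaveSourced_sub_le`: for EVERY
  state the sourced mean energy is affine in the couplings with UNIFORMLY bounded slopes (double occupancy,
  diagonal-hopping energy, density, pair amplitude — each bounded by the norm of a fixed local observable), so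
  `ω ↦ e_{Ψ_c}(ω) − e_{Ψ_{c'}}(ω)` is small uniformly in `ω` when `c' → c`.
* §2 **`isMeanEnergyMinimiser_dWaveSourced_of_tendsto`: THE GROUND-STATE CORRESPONDENCE HAS CLOSED GRAPH** —
  if `c_j → c`, `ω_j` is a translation-invariant ground state at `c_j`, and `ω_j → ω` on every local algebra,
  then `ω` is a translation-invariant ground state at `c` (uses §1, the joint continuity of `e_src`, and
  `e_src(c) = e₀(Ψ_c)`); `exists_subseq_tendsto_isMeanEnergyMinimiser_dWaveSourced`: every sequence of ground
  states over a convergent sequence of couplings has a subsequence converging to a ground state at the limit.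
* §3 **JOINT UPPER SEMICONTINUITY OF THE PAIR AMPLITUDE**:
  `eventually_re_expect_localPairAt_lt_of_tendsto` — for ground states `ω_j` at `(t'_j,U_j,μ_j,h_j) → (t',U,μ,h)`
  and every `ε > 0`, eventually `Re ω_j(P₀^d) < m(t',U,μ; h) + ε`, `m = −∂⁺E(h)/2` the greatest amplitude at the
  limit point (Berge: closed graph + compact values); at `h = 0` the bound is `m⋆(t',U,μ) + ε`
  (`eventually_re_expect_localPairAt_lt_dWaveOrderParameterTT'_add`): **every joint limit of finite-field
  translation-invariant ground-state amplitudes — couplings drifting with the field — is at most `m⋆`**; and the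
  state-level form of «PRESENT cells are closed»: a uniform amplitude floor `a ≤ Re ω_j(P₀^d)` along ground states
  at `c_j → c` forces `a ≤ m(c)` resp. `a ≤ m⋆(c)` (`le_neg_half_rightDeriv_of_minimisers_tendsto`,
  `le_dWaveOrderParameterTT'_of_minimisers_tendsto`).

READING. The order parameter is u.s.c. (R1) because the SET of ground states is: ground states of nearby
couplings accumulate only at ground states. HONEST SCOPE: qualitative structure; ceiling-side; nothing here
floors `d`-wave order.

## References
* O. Bratteli, A. Kishimoto, D. W. Robinson, Commun. Math. Phys. 64 (1978) 41, Thm. 2 (translation-invariant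
  ground states = mean-energy minimisers). [cite: BratteliKishimotoRobinson1978, Thm. 2]
* R. B. Israel, *Convexity in the Theory of Lattice Gases* (1979), Thm. I.3.4 (the mean energy is Lipschitz in the
  interaction uniformly in the state). [cite: Israel1979, Thm. I.3.4]
* R. T. Rockafellar, *Convex Analysis* (1970), Thm. 24.4 (closed graph of the subdifferential) and Thm. 24.5.
  [cite: Rockafellar1970, Thm. 24.4]
* T. Koma, H. Tasaki, J. Stat. Phys. 76 (1994) 745–803, §1. [cite: KomaTasaki1994, §1]
-/

noncomputable section

namespace Literature.MathematicalPhysics.QuantumLattice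

open _root_.Filter Set Literature.Probability.LatticeModels HubbardWave0 Finset
open scoped _root_.Topology

/-! ### §1 The sourced mean energy is affine in the couplings with uniformly bounded slopes -/

namespace InfVolFermionState

/-- **Affinity of the sourced mean energy in the couplings, every state**:
`e_{Ψ(t',U,μ,h)}(ω) − e_{Ψ(t'₀,U₀,μ₀,h₀)}(ω) = (U−U₀)D(ω) + (t'−t'₀)K₂(ω) − (μ−μ₀)ρ(ω) − (h−h₀)e_P(ω)`.
[cite: BratteliKishimotoRobinson1978, Thm. 2] -/
theorem meanEnergy_dWaveSourced_sub_eq (ω : InfVolFermionState 2) (t'₀ U₀ μ₀ h₀ t' U μ h : ℝ) :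
    ω.meanEnergy (hubbardTTPrimeSourcedInteraction 1 t' U μ dWaveFormFactor h) 1 -
        ω.meanEnergy (hubbardTTPrimeSourcedInteraction 1 t'₀ U₀ μ₀ dWaveFormFactor h₀) 1 =
      (U - U₀) * ω.meanEnergy (hubbardTTPrimeFermionInteraction 0 0 1) 1 +
        (t' - t'₀) * ω.meanEnergy (hubbardTTPrimeFermionInteraction 0 1 0) 1 -
        (μ - μ₀) * ω.density - (h - h₀) * ω.meanEnergy (pairSourceInteraction dWaveFormFactor) 1 := by
  rw [InfVolFermionState.meanEnergy_hubbardTTPrimeSourced, InfVolFermionState.meanEnergy_hubbardTTPrimeSourced,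
    ω.meanEnergy_hubbardTTPrime_affine 1 t'₀ U₀ t' U]
  ring

open scoped Matrix.Norms.L2Operator in
/-- **Uniform Lipschitz bound in the couplings, every state**: with the operator norms `C_D, C_K, C_P` of the
mean-energy observables of `Φ(0,0,1)`, `Φ(0,1,0)` and of the `d`-wave pair source (state-independent
constants) and `0 ≤ ρ ≤ 2`,
`|e_{Ψ(c)}(ω) − e_{Ψ(c₀)}(ω)| ≤ |U−U₀|C_D + |t'−t'₀|C_K + 2|μ−μ₀| + |h−h₀|C_P`. [cite: Israel1979, Thm. I.3.4] -/
theorem abs_meanEnergy_dWaveSourced_sub_le (ω : InfVolFermionState 2) (t'₀ U₀ μ₀ h₀ t' U μ h : ℝ) :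
    |ω.meanEnergy (hubbardTTPrimeSourcedInteraction 1 t' U μ dWaveFormFactor h) 1 -
        ω.meanEnergy (hubbardTTPrimeSourcedInteraction 1 t'₀ U₀ μ₀ dWaveFormFactor h₀) 1| ≤
      |U - U₀| * ‖(hubbardTTPrimeFermionInteraction 0 0 1).meanEnergyObs 1‖ +
        |t' - t'₀| * ‖(hubbardTTPrimeFermionInteraction 0 1 0).meanEnergyObs 1‖ + 2 * |μ - μ₀| +
        |h - h₀| * ‖(pairSourceInteraction dWaveFormFactor).meanEnergyObs 1‖ := by
  rw [ω.meanEnergy_dWaveSourced_sub_eq]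
  have hD := ω.abs_meanEnergy_le_norm (hubbardTTPrimeFermionInteraction 0 0 1) 1
  have hK := ω.abs_meanEnergy_le_norm (hubbardTTPrimeFermionInteraction 0 1 0) 1
  have hP := ω.abs_meanEnergy_le_norm (pairSourceInteraction dWaveFormFactor) 1
  have hρ : |ω.density| ≤ 2 := by
    rw [abs_of_nonneg ω.density_nonneg]
    exact ω.density_le_two
  have h1 : |(U - U₀) * ω.meanEnergy (hubbardTTPrimeFermionInteraction 0 0 1) 1| ≤
      |U - U₀| * ‖(hubbardTTPrimeFermionInteraction 0 0 1).meanEnergyObs 1‖ := by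
    rw [abs_mul]; exact mul_le_mul_of_nonneg_left hD (abs_nonneg _)
  have h2 : |(t' - t'₀) * ω.meanEnergy (hubbardTTPrimeFermionInteraction 0 1 0) 1| ≤
      |t' - t'₀| * ‖(hubbardTTPrimeFermionInteraction 0 1 0).meanEnergyObs 1‖ := by
    rw [abs_mul]; exact mul_le_mul_of_nonneg_left hK (abs_nonneg _)
  have h3 : |(μ - μ₀) * ω.density| ≤ 2 * |μ - μ₀| := by
    rw [abs_mul, mul_comm 2]; exact mul_le_mul_of_nonneg_left hρ (abs_nonneg _)
  have h4 : |(h - h₀) * ω.meanEnergy (pairSourceInteraction dWaveFormFactor) 1| ≤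
      |h - h₀| * ‖(pairSourceInteraction dWaveFormFactor).meanEnergyObs 1‖ := by
    rw [abs_mul]; exact mul_le_mul_of_nonneg_left hP (abs_nonneg _)
  calc _ ≤ |(U - U₀) * ω.meanEnergy (hubbardTTPrimeFermionInteraction 0 0 1) 1 +
        (t' - t'₀) * ω.meanEnergy (hubbardTTPrimeFermionInteraction 0 1 0) 1 - (μ - μ₀) * ω.density| +
        |(h - h₀) * ω.meanEnergy (pairSourceInteraction dWaveFormFactor) 1| := abs_sub _ _
    _ ≤ (|(U - U₀) * ω.meanEnergy (hubbardTTPrimeFermionInteraction 0 0 1) 1 +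
        (t' - t'₀) * ω.meanEnergy (hubbardTTPrimeFermionInteraction 0 1 0) 1| + |(μ - μ₀) * ω.density|) +
        |(h - h₀) * ω.meanEnergy (pairSourceInteraction dWaveFormFactor) 1| := by
      gcongr; exact abs_sub _ _
    _ ≤ (|(U - U₀) * ω.meanEnergy (hubbardTTPrimeFermionInteraction 0 0 1) 1| +
        |(t' - t'₀) * ω.meanEnergy (hubbardTTPrimeFermionInteraction 0 1 0) 1| + |(μ - μ₀) * ω.density|) +
        |(h - h₀) * ω.meanEnergy (pairSourceInteraction dWaveFormFactor) 1| := by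
      gcongr; exact abs_add_le _ _
    _ ≤ _ := by linarith

/-- **Uniform smallness along a convergent sequence of couplings**: if `(t'_j,U_j,μ_j,h_j) → (t',U,μ,h)` then
`sup_ω |e_{Ψ(c)}(ω) − e_{Ψ(c_j)}(ω)| → 0` — as an explicit state-independent majorant tending to `0`.
[cite: Israel1979, Thm. I.3.4] -/
theorem exists_tendsto_zero_abs_meanEnergy_dWaveSourced_sub_le {tp U μ h : ℕ → ℝ} {tp₀ U₀ μ₀ h₀ : ℝ}
    (htp : Tendsto tp atTop (𝓝 tp₀)) (hU : Tendsto U atTop (𝓝 U₀)) (hμ : Tendsto μ atTop (𝓝 μ₀))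
    (hh : Tendsto h atTop (𝓝 h₀)) :
    ∃ b : ℕ → ℝ, Tendsto b atTop (𝓝 0) ∧ ∀ (j : ℕ) (ω : InfVolFermionState 2),
      |ω.meanEnergy (hubbardTTPrimeSourcedInteraction 1 tp₀ U₀ μ₀ dWaveFormFactor h₀) 1 -
          ω.meanEnergy (hubbardTTPrimeSourcedInteraction 1 (tp j) (U j) (μ j) dWaveFormFactor (h j)) 1| ≤ b j := by
  classical
  obtain ⟨CD, hCD⟩ : ∃ C : ℝ, ∀ ω : InfVolFermionState 2,
      |ω.meanEnergy (hubbardTTPrimeFermionInteraction 0 0 1) 1| ≤ C :=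
    ⟨_, fun ω => ω.abs_meanEnergy_le_norm (hubbardTTPrimeFermionInteraction 0 0 1) 1⟩
  obtain ⟨CK, hCK⟩ : ∃ C : ℝ, ∀ ω : InfVolFermionState 2,
      |ω.meanEnergy (hubbardTTPrimeFermionInteraction 0 1 0) 1| ≤ C :=
    ⟨_, fun ω => ω.abs_meanEnergy_le_norm (hubbardTTPrimeFermionInteraction 0 1 0) 1⟩
  obtain ⟨CP, hCP⟩ : ∃ C : ℝ, ∀ ω : InfVolFermionState 2,
      |ω.meanEnergy (pairSourceInteraction dWaveFormFactor) 1| ≤ C :=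
    ⟨_, fun ω => ω.abs_meanEnergy_le_norm (pairSourceInteraction dWaveFormFactor) 1⟩
  refine ⟨fun j => |U₀ - U j| * CD + |tp₀ - tp j| * CK + 2 * |μ₀ - μ j| + |h₀ - h j| * CP, ?_, fun j ω => ?_⟩
  · have hU' : Tendsto (fun j => |U₀ - U j| * CD) atTop (𝓝 0) := by
      have := ((tendsto_const_nhds (x := U₀)).sub hU).abs.mul_const CD
      simpa using this
    have htp' : Tendsto (fun j => |tp₀ - tp j| * CK) atTop (𝓝 0) := by
      have := ((tendsto_const_nhds (x := tp₀)).sub htp).abs.mul_const CK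
      simpa using this
    have hμ' : Tendsto (fun j => 2 * |μ₀ - μ j|) atTop (𝓝 0) := by
      have := ((tendsto_const_nhds (x := μ₀)).sub hμ).abs.const_mul 2
      simpa using this
    have hh' : Tendsto (fun j => |h₀ - h j| * CP) atTop (𝓝 0) := by
      have := ((tendsto_const_nhds (x := h₀)).sub hh).abs.mul_const CP
      simpa using this
    simpa using ((hU'.add htp').add hμ').add hh'
  · rw [ω.meanEnergy_dWaveSourced_sub_eq]
    have h1 : |(U₀ - U j) * ω.meanEnergy (hubbardTTPrimeFermionInteraction 0 0 1) 1| ≤ |U₀ - U j| * CD := by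
      rw [abs_mul]; exact mul_le_mul_of_nonneg_left (hCD ω) (abs_nonneg _)
    have h2 : |(tp₀ - tp j) * ω.meanEnergy (hubbardTTPrimeFermionInteraction 0 1 0) 1| ≤ |tp₀ - tp j| * CK := by
      rw [abs_mul]; exact mul_le_mul_of_nonneg_left (hCK ω) (abs_nonneg _)
    have h3 : |(μ₀ - μ j) * ω.density| ≤ 2 * |μ₀ - μ j| := by
      rw [abs_mul, mul_comm 2]
      refine mul_le_mul_of_nonneg_left ?_ (abs_nonneg _)
      rw [abs_of_nonneg ω.density_nonneg]
      exact ω.density_le_two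
    have h4 : |(h₀ - h j) * ω.meanEnergy (pairSourceInteraction dWaveFormFactor) 1| ≤ |h₀ - h j| * CP := by
      rw [abs_mul]; exact mul_le_mul_of_nonneg_left (hCP ω) (abs_nonneg _)
    have e1 := abs_add_le ((U₀ - U j) * ω.meanEnergy (hubbardTTPrimeFermionInteraction 0 0 1) 1)
      ((tp₀ - tp j) * ω.meanEnergy (hubbardTTPrimeFermionInteraction 0 1 0) 1)
    have e2 := abs_sub ((U₀ - U j) * ω.meanEnergy (hubbardTTPrimeFermionInteraction 0 0 1) 1 +
      (tp₀ - tp j) * ω.meanEnergy (hubbardTTPrimeFermionInteraction 0 1 0) 1) ((μ₀ - μ j) * ω.density)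
    have e3 := abs_sub ((U₀ - U j) * ω.meanEnergy (hubbardTTPrimeFermionInteraction 0 0 1) 1 +
      (tp₀ - tp j) * ω.meanEnergy (hubbardTTPrimeFermionInteraction 0 1 0) 1 - (μ₀ - μ j) * ω.density)
      ((h₀ - h j) * ω.meanEnergy (pairSourceInteraction dWaveFormFactor) 1)
    linarith

end InfVolFermionState

/-! ### §2 Closed graph of the ground-state correspondence -/

section ClosedGraph

variable {ω : ℕ → InfVolFermionState 2} {ωl : InfVolFermionState 2} {tp U μ h : ℕ → ℝ} {tp₀ U₀ μ₀ h₀ : ℝ}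

/-- `e_src` is continuous along a convergent sequence of couplings. [cite: Rockafellar1970, Thm. 24.4] -/
theorem tendsto_dWaveSourceEnergyDensityTT'_of_tendsto_couplings
    (htp : Tendsto tp atTop (𝓝 tp₀)) (hU : Tendsto U atTop (𝓝 U₀)) (hμ : Tendsto μ atTop (𝓝 μ₀))
    (hh : Tendsto h atTop (𝓝 h₀)) :
    Tendsto (fun j => dWaveSourceEnergyDensityTT' (tp j) (U j) (μ j) (h j)) atTop
      (𝓝 (dWaveSourceEnergyDensityTT' tp₀ U₀ μ₀ h₀)) := by
  have hc : Tendsto (fun j => ((tp j, U j, μ j, h j) : ℝ × ℝ × ℝ × ℝ)) atTop (𝓝 (tp₀, U₀, μ₀, h₀)) :=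
    htp.prodMk_nhds (hU.prodMk_nhds (hμ.prodMk_nhds hh))
  have key := (continuous_dWaveSourceEnergyDensityTT'_couplings.tendsto (tp₀, U₀, μ₀, h₀)).comp hc
  simpa only [Function.comp_def] using key

/-- **THE GROUND-STATE CORRESPONDENCE HAS CLOSED GRAPH.** Let `(t'_j,U_j,μ_j,h_j) → (t',U,μ,h)`, let `ω_j` be a
translation-invariant ground state (mean-energy minimiser) of the sourced `t–t'` interaction at
`(t'_j,U_j,μ_j,h_j)`, and let `ω_j → ω` on every local algebra. Then `ω` is a translation-invariant ground state
at `(t',U,μ,h)`: `e_{Ψ(c)}(ω) = lim e_{Ψ(c)}(ω_j) = lim [e_src(c_j) + O(|c − c_j|)] = e_src(c) = e₀(Ψ(c))`.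
[cite: Rockafellar1970, Thm. 24.4] -/
theorem isMeanEnergyMinimiser_dWaveSourced_of_tendsto
    (hlim : ∀ (Λ : Finset (Site 2)) (A : FermionOp Λ), Tendsto (fun j => (ω j).expect Λ A) atTop (𝓝 (ωl.expect Λ A)))
    (htp : Tendsto tp atTop (𝓝 tp₀)) (hU : Tendsto U atTop (𝓝 U₀)) (hμ : Tendsto μ atTop (𝓝 μ₀))
    (hh : Tendsto h atTop (𝓝 h₀))
    (hmin : ∀ j, (ω j).IsMeanEnergyMinimiser
      (hubbardTTPrimeSourcedInteraction 1 (tp j) (U j) (μ j) dWaveFormFactor (h j)) 1) :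
    ωl.IsMeanEnergyMinimiser (hubbardTTPrimeSourcedInteraction 1 tp₀ U₀ μ₀ dWaveFormFactor h₀) 1 := by
  refine InfVolFermionState.isMeanEnergyMinimiser_iff.2
    ⟨InfVolFermionState.isTranslationInvariant_of_tendsto_expect hlim fun j => (hmin j).1, ?_⟩
  set Ψ₀ := hubbardTTPrimeSourcedInteraction 1 tp₀ U₀ μ₀ dWaveFormFactor h₀ with hΨ₀
  -- the mean energies of the fixed interaction `Ψ₀` converge to `e_{Ψ₀}(ωl)`
  have h1 := InfVolFermionState.tendsto_meanEnergy_of_tendsto_expect hlim Ψ₀ 1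
  -- and they equal `e_src(c_j)` plus a uniformly small error
  obtain ⟨b, hb, hbd⟩ :=
    InfVolFermionState.exists_tendsto_zero_abs_meanEnergy_dWaveSourced_sub_le htp hU hμ hh
  have h2 : ∀ j, (ω j).meanEnergy (hubbardTTPrimeSourcedInteraction 1 (tp j) (U j) (μ j) dWaveFormFactor (h j)) 1 =
      dWaveSourceEnergyDensityTT' (tp j) (U j) (μ j) (h j) := fun j => by
    rw [(hmin j).meanEnergy_eq, dWaveSourceEnergyDensityTT'_eq_tiGroundEnergyDensity]
  have h3 := tendsto_dWaveSourceEnergyDensityTT'_of_tendsto_couplings htp hU hμ hh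
  have h4 : Tendsto (fun j => (ω j).meanEnergy Ψ₀ 1 -
      (ω j).meanEnergy (hubbardTTPrimeSourcedInteraction 1 (tp j) (U j) (μ j) dWaveFormFactor (h j)) 1) atTop (𝓝 0) :=
    squeeze_zero_norm (fun j => by simpa only [Real.norm_eq_abs] using hbd j (ω j)) hb
  have h5 : Tendsto (fun j => (ω j).meanEnergy Ψ₀ 1) atTop (𝓝 (0 + dWaveSourceEnergyDensityTT' tp₀ U₀ μ₀ h₀)) := by
    have := h4.add h3
    refine this.congr' (Eventually.of_forall fun j => ?_)
    simp only [h2, sub_add_cancel]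
  rw [zero_add] at h5
  rw [tendsto_nhds_unique h1 h5, hΨ₀, dWaveSourceEnergyDensityTT'_eq_tiGroundEnergyDensity]

/-- **Ground states over convergent couplings accumulate at ground states**: every sequence of
translation-invariant ground states `ω_j` at `(t'_j,U_j,μ_j,h_j) → (t',U,μ,h)` has a subsequence converging on
every local algebra to a translation-invariant ground state at `(t',U,μ,h)` (weak-⋆ compactness + closed graph).
[cite: BratteliKishimotoRobinson1978, Thm. 2] -/
theorem exists_subseq_tendsto_isMeanEnergyMinimiser_dWaveSourced
    (htp : Tendsto tp atTop (𝓝 tp₀)) (hU : Tendsto U atTop (𝓝 U₀)) (hμ : Tendsto μ atTop (𝓝 μ₀))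
    (hh : Tendsto h atTop (𝓝 h₀))
    (hmin : ∀ j, (ω j).IsMeanEnergyMinimiser
      (hubbardTTPrimeSourcedInteraction 1 (tp j) (U j) (μ j) dWaveFormFactor (h j)) 1) :
    ∃ φ : ℕ → ℕ, StrictMono φ ∧ ∃ ωl : InfVolFermionState 2,
      (∀ (Λ : Finset (Site 2)) (A : FermionOp Λ),
        Tendsto (fun j => (ω (φ j)).expect Λ A) atTop (𝓝 (ωl.expect Λ A))) ∧
      ωl.IsMeanEnergyMinimiser (hubbardTTPrimeSourcedInteraction 1 tp₀ U₀ μ₀ dWaveFormFactor h₀) 1 := by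
  obtain ⟨φ, hφ, ωl, hlim⟩ := InfVolFermionState.exists_tendsto_expect_subseq ω
  refine ⟨φ, hφ, ωl, hlim, ?_⟩
  exact isMeanEnergyMinimiser_dWaveSourced_of_tendsto hlim (htp.comp hφ.tendsto_atTop) (hU.comp hφ.tendsto_atTop)
    (hμ.comp hφ.tendsto_atTop) (hh.comp hφ.tendsto_atTop) fun j => hmin (φ j)

end ClosedGraph

/-! ### §3 Joint upper semicontinuity of the pair amplitude of ground states -/

section Amplitude

variable {ω : ℕ → InfVolFermionState 2} {tp U μ h : ℕ → ℝ} {tp₀ U₀ μ₀ h₀ : ℝ}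

/-- **A uniform amplitude floor along ground states at converging couplings survives at the limit**: if
`a ≤ Re ω_j(P₀^d)` for translation-invariant ground states `ω_j` at `(t'_j,U_j,μ_j,h_j) → (t',U,μ,h)`, then some
translation-invariant ground state at the limit point has `a ≤ Re ω(P₀^d)`, hence
`a ≤ m(t',U,μ; h) = −∂⁺E(h)/2`, the greatest ground-state amplitude there. [cite: Rockafellar1970, Thm. 24.5] -/
theorem le_neg_half_rightDeriv_of_minimisers_tendsto
    (htp : Tendsto tp atTop (𝓝 tp₀)) (hU : Tendsto U atTop (𝓝 U₀)) (hμ : Tendsto μ atTop (𝓝 μ₀))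
    (hh : Tendsto h atTop (𝓝 h₀))
    (hmin : ∀ j, (ω j).IsMeanEnergyMinimiser
      (hubbardTTPrimeSourcedInteraction 1 (tp j) (U j) (μ j) dWaveFormFactor (h j)) 1)
    {a : ℝ} (ha : ∀ j, a ≤ ((ω j).expect (pairRegion (insert (0 : Site 2) unitSteps) 0)
      (localPairAt (insert 0 unitSteps) dWaveFormFactor 0)).re) :
    a ≤ -derivWithin (dWaveSourceEnergyDensityTT' tp₀ U₀ μ₀) (Ioi h₀) h₀ / 2 := by
  obtain ⟨φ, hφ, ωl, hlim, hωl⟩ := exists_subseq_tendsto_isMeanEnergyMinimiser_dWaveSourced htp hU hμ hh hmin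
  have hP := (Complex.continuous_re.tendsto _).comp
    (hlim (pairRegion (insert (0 : Site 2) unitSteps) 0) (localPairAt (insert 0 unitSteps) dWaveFormFactor 0))
  have hale : a ≤ (ωl.expect (pairRegion (insert (0 : Site 2) unitSteps) 0)
      (localPairAt (insert 0 unitSteps) dWaveFormFactor 0)).re :=
    ge_of_tendsto' hP fun j => ha (φ j)
  exact hale.trans ((isGreatest_re_expect_localPairAt_sourcedGroundStates tp₀ U₀ μ₀ h₀).2 ⟨ωl, hωl, rfl⟩)

/-- **JOINT UPPER SEMICONTINUITY of the ground-state pair amplitude** (Berge): for translation-invariant ground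
states `ω_j` at `(t'_j,U_j,μ_j,h_j) → (t',U,μ,h)` and every `ε > 0`, eventually
`Re ω_j(P₀^d) < m(t',U,μ; h) + ε`. [cite: Rockafellar1970, Thm. 24.5] -/
theorem eventually_re_expect_localPairAt_lt_of_tendsto
    (htp : Tendsto tp atTop (𝓝 tp₀)) (hU : Tendsto U atTop (𝓝 U₀)) (hμ : Tendsto μ atTop (𝓝 μ₀))
    (hh : Tendsto h atTop (𝓝 h₀))
    (hmin : ∀ j, (ω j).IsMeanEnergyMinimiser
      (hubbardTTPrimeSourcedInteraction 1 (tp j) (U j) (μ j) dWaveFormFactor (h j)) 1)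
    {ε : ℝ} (hε : 0 < ε) :
    ∀ᶠ j in atTop, ((ω j).expect (pairRegion (insert (0 : Site 2) unitSteps) 0)
        (localPairAt (insert 0 unitSteps) dWaveFormFactor 0)).re <
      -derivWithin (dWaveSourceEnergyDensityTT' tp₀ U₀ μ₀) (Ioi h₀) h₀ / 2 + ε := by
  by_contra hne
  rw [Filter.not_eventually] at hne
  simp only [not_lt] at hne
  obtain ⟨ψ, hψ, hψP⟩ := extraction_of_frequently_atTop hne
  have key := le_neg_half_rightDeriv_of_minimisers_tendsto (ω := fun j => ω (ψ j))
    (htp.comp hψ.tendsto_atTop) (hU.comp hψ.tendsto_atTop) (hμ.comp hψ.tendsto_atTop) (hh.comp hψ.tendsto_atTop)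
    (fun j => hmin (ψ j)) (a := -derivWithin (dWaveSourceEnergyDensityTT' tp₀ U₀ μ₀) (Ioi h₀) h₀ / 2 + ε)
    fun j => hψP j
  linarith

/-- **At zero field: every joint limit of finite-field ground-state amplitudes is at most `m⋆`.** For
translation-invariant ground states `ω_j` at `(t'_j,U_j,μ_j,h_j) → (t',U,μ,0)` (couplings AND field may move)
and every `ε > 0`, eventually `Re ω_j(P₀^d) < dWaveOrderParameterTT' t' U μ + ε`. [cite: KomaTasaki1994, §1] -/
theorem eventually_re_expect_localPairAt_lt_dWaveOrderParameterTT'_add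
    (htp : Tendsto tp atTop (𝓝 tp₀)) (hU : Tendsto U atTop (𝓝 U₀)) (hμ : Tendsto μ atTop (𝓝 μ₀))
    (hh : Tendsto h atTop (𝓝 0))
    (hmin : ∀ j, (ω j).IsMeanEnergyMinimiser
      (hubbardTTPrimeSourcedInteraction 1 (tp j) (U j) (μ j) dWaveFormFactor (h j)) 1)
    {ε : ℝ} (hε : 0 < ε) :
    ∀ᶠ j in atTop, ((ω j).expect (pairRegion (insert (0 : Site 2) unitSteps) 0)
        (localPairAt (insert 0 unitSteps) dWaveFormFactor 0)).re < dWaveOrderParameterTT' tp₀ U₀ μ₀ + ε := by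
  rw [dWaveOrderParameterTT'_eq_neg_half_rightDeriv]
  exact eventually_re_expect_localPairAt_lt_of_tendsto htp hU hμ hh hmin hε

/-- **«PRESENT cells are closed» at the level of states**: a uniform amplitude floor `a ≤ Re ω_j(P₀^d)` along
translation-invariant ground states at `(t'_j,U_j,μ_j,h_j) → (t',U,μ,0)` forces `a ≤ dWaveOrderParameterTT' t' U μ`.
[cite: KomaTasaki1994, §1] -/
theorem le_dWaveOrderParameterTT'_of_minimisers_tendsto
    (htp : Tendsto tp atTop (𝓝 tp₀)) (hU : Tendsto U atTop (𝓝 U₀)) (hμ : Tendsto μ atTop (𝓝 μ₀))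
    (hh : Tendsto h atTop (𝓝 0))
    (hmin : ∀ j, (ω j).IsMeanEnergyMinimiser
      (hubbardTTPrimeSourcedInteraction 1 (tp j) (U j) (μ j) dWaveFormFactor (h j)) 1)
    {a : ℝ} (ha : ∀ j, a ≤ ((ω j).expect (pairRegion (insert (0 : Site 2) unitSteps) 0)
      (localPairAt (insert 0 unitSteps) dWaveFormFactor 0)).re) :
    a ≤ dWaveOrderParameterTT' tp₀ U₀ μ₀ := by
  refine le_of_forall_pos_lt_add fun ε hε => ?_
  obtain ⟨j, hj⟩ := (eventually_re_expect_localPairAt_lt_dWaveOrderParameterTT'_add htp hU hμ hh hmin hε).exists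
  exact (ha j).trans_lt hj

/-- **The zero-field case with fixed couplings, as a `limsup`-free reading of the quasi-average**: for any
sources `h_j → 0` (from either side, any speed) and translation-invariant sourced ground states `ω_j` at
`(t',U,μ,h_j)`, every amplitude floor holding along the sequence is `≤ m⋆(t',U,μ)`. [cite: KomaTasaki1994, §1] -/
theorem le_dWaveOrderParameterTT'_of_minimisers_vanishing_source (t' U μ : ℝ) {hs : ℕ → ℝ}
    (hh : Tendsto hs atTop (𝓝 0))
    (hmin : ∀ j, (ω j).IsMeanEnergyMinimiser (hubbardTTPrimeSourcedInteraction 1 t' U μ dWaveFormFactor (hs j)) 1)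
    {a : ℝ} (ha : ∀ j, a ≤ ((ω j).expect (pairRegion (insert (0 : Site 2) unitSteps) 0)
      (localPairAt (insert 0 unitSteps) dWaveFormFactor 0)).re) :
    a ≤ dWaveOrderParameterTT' t' U μ :=
  le_dWaveOrderParameterTT'_of_minimisers_tendsto (tp := fun _ => t') (U := fun _ => U) (μ := fun _ => μ)
    tendsto_const_nhds tendsto_const_nhds tendsto_const_nhds hh hmin ha

end Amplitude

end Literature.MathematicalPhysics.QuantumLattice
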